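import Summits.QuantumFields.YangMills.Theorems.BalabanUVNodesK0Beta13RadiusBlind
import Summits.QuantumFields.YangMills.Theorems.BalabanUVNodesN09BackgroundRadiiTransfer

/-!
# K0⁷ — RADIUS BLINDNESS OF THE β OF RECORD BY RESTRICTION: (T2″) instantiated at a FIRST-FORM (background-regularity) domain system, rows (N)(B)(hU) derived from
# [15]-SHAPED displayed rows — restriction (9)–(10), uniqueness (1.1), Lipschitz-(8) on the (2.9)-collar — and the §2 choice-rigidity lemma; DOWNWARD agreement free, UPWARD from (8)

Cell `pub-ymgap`, width seat `pub-ymgap-dag-n07-w3` (g19; N07 [B11] ∕ K0⁷ junction).  `--kind proof --supports stmt-QuantumFields-20541 --as helper`, COUNT-NEUTRAL.  NEW leaf;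
theorems only — 0 `def`, 0 `sorry`, 0 `instance`, 0 `notation`.  Imports this seat's (T2″) `…K0Beta13RadiusBlind` (✓p785962) and dag-n09-w1's `…N09BackgroundRadiiTransfer`
(nested-class transfer lemmas `bgReg_mono` ∕ `mem_bgReg_iff_of_orbitRel` ∕ `isBackground_superset_of_exists_mem` ∕ `isBackground_of_le_of_mem`).
[I] = [Balaban1987RG1]; [15] = [Balaban1985Variational]; [B7] = [Balaban1985Averaging].

WHY (this seat's ERRATUM E-n07w3-g19-1 to LOCATED-2, evidence on 20541; P3 g85 «candidate carrier of record … pending CRIT-1»).  The CLASS-BOUND instantiation (T2‴) of (T2″)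
(plaquette domains `{|∂V − 1| < ε₀}`, rows from n09's `hcrit_of_ukExists`∕`hord`) forces `ε₀ ≥ 2ā∕L²` and then [15] (8) (constant `B₃ ≥ 2L²`, [15] p.303 (160)–(162)) never returns the
larger-radius minimisers to `bgReg ā`: its selector row is idle.  The mechanism print's own induction uses is RESTRICTION ([15] Thm 1 (9)–(10), [I] (1.1) «exactly one regular critical
orbit»): the background of the averaged background `Ū^k(U_{k+1}(a; W))` IS `U_{k+1}(a; W)`, so on FIRST-FORM domains `{V | every radius-a minimiser over V is ρ·η²-regular}` row (B) is
LOSSLESS (indeed GAINS `1∕L²` per level by the rescaling `η_{k+1}² = η_k²∕L²`), row (N) is ONE displayed Lipschitz-(8) row on the (2.9)-collar ([15] §F), and the selector row (hU) is FREE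
downward (`a′ ≤ a`, `ρ ≤ a′`: a radius-`a` minimiser that is `a′`-regular minimises in the smaller class — mutual minimality + choice rigidity) and costs one (8)-shaped row upward.

CONTENTS.  §1 CHOICE RIGIDITY of the selector of record (adapted from seat cruxidea-…-20541-3's `Cruxes/Record13SepCoPHInhabited/RadiusCollapseSketch.lean` §1, re-proved here because
crux workfiles are not importable): `Uk_eq_of_forall_isBackground_iff` (equal minimiser predicates ⇒ THE SAME selected configuration), `Uk_eq_of_le_of_forall_isBackground_mem` (L2).
§2 `bgReg_succ_subset` (the rescaling gain).  §3 ★ `betaOfRecord₁₃_thm1CCMWZB_radiusBlind_firstForm` — (T2″) with rows (N)(B) DERIVED from the first-form sandwich (hsub)(hsup), restriction (hR),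
uniqueness (hQ) and the collar row (hS); selector row (hU) still displayed.  §4 ★★ `…_firstForm_down` (`a′ ≤ a`, `0 ≤ ρ ≤ a′`: (hU) DISCHARGED from (hsub)) and ★ `…_firstForm_up`
(`a ≤ a′`: (hU) from the (8)-shaped row (h8up) «radius-a′ minimisers over the domain are a-regular» + solvability at a′).

HONEST FRAMING (binding).  A by-name composition; NO β estimate; nothing of Bałaban's asserted.  DISPLAYED rows and their print species: (hsub)∕(hsup) = the domain system IS the
first-form domain of regularity ρ at radius a (def-R's `domOfRecord` species) — with (hUo) «it is open» = continuity of `V ↦ U_k(V)` ([15] §F) NOT proved here; (hR) = [15] Thm 1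
(9)–(10) ∕ [I] (1.1) restriction (tree species `Node00.BackgroundActionT.HRestrict`); (hQ) = [I] (1.1) uniqueness (`UniqueUkOrbit`); (hS) = Lipschitz form of (8) on the (2.9)-collar
([15] §F; NOT in the tree); (hT) = row P7 continuity of the transform (ONE radius); (h8up) = [15] Thm 1 (8) + existence at the larger radius.  None is discharged; N07's content.  Seat -3's
(T2) AS TYPED is not proved.  Stub 2′ OPEN; K0⁷ stmt-QuantumFields-20541 NOT closed; N07 NOT discharged; COUNT 8∕28 · K 1∕4 UNMOVED; NODE O = [I] Thm 3 β-clause p.264 — print-proved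
(claimed), UNPORTED; R4 = the CONDITIONAL finite-𝕋⁴ rung `BalabanLadder.UV` at fixed `ε = L^(−K)` only — NOT continuum ∕ ℝ⁴ ∕ OS; the Yang–Mills mass gap (Clay) is NOT proved by any of this.
-/

noncomputable section

open MeasureTheory Set Filter
open scoped Matrix.Norms.L2Operator

namespace Summit.QuantumFields.YangMills.BalabanUVNodes.K0Beta13RadiusBlindFirstForm

open Literature.MathematicalPhysics.QuantumFieldTheory.Balaban1983to89
open Literature.MathematicalPhysics.QuantumFieldTheory.Balaban1983to89.Node00
open Literature.MathematicalPhysics.QuantumFieldTheory.Balaban1983to89.T4Continuum (T4Family)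
open B12Eq019ActionBody (integrand)
open Summit.QuantumFields.YangMills.BalabanUVNodes.K0Beta13RadiusBlind (betaOfRecord₁₃_thm1CCMWZB_radiusBlind_of_readSet)
open Summit.QuantumFields.YangMills.BalabanUVNodes.N09BackgroundRadiiTransfer (bgReg_mono mem_bgReg_iff_of_orbitRel isBackground_superset_of_exists_mem isBackground_of_le_of_mem)

/-! ## §1  Choice rigidity of the background selector of record (seat -3's L1∕L2, re-proved) -/

section ChoiceRigidity

variable {F : T4Family} {N : ℕ} [NeZero N] {K k : ℕ} {ε ε' : ℝ} {V : GaugeField (F.P K) k (Node00.SU N)}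

/-- **CHOICE RIGIDITY** (seat cruxidea-…-20541-3's L1): if the minimiser predicates of (0.21) at radii `ε`, `ε′` agree extensionally at `V`, the selectors of record pick THE SAME configuration
(both are `Classical.choose` of the same predicate, or both the junk default). [cite: Balaban1987RG1, (0.21) p.256 (bookkeeping)] -/
theorem Uk_eq_of_forall_isBackground_iff
    (h : ∀ U₀, IsBackground (avOfRecord F N K) (bgReg F N K k ε) k V U₀ ↔ IsBackground (avOfRecord F N K) (bgReg F N K k ε') k V U₀) :
    Uk F N K k ε V = Uk F N K k ε' V := by
  -- adapted from Cruxes/Record13SepCoPHInhabited/RadiusCollapseSketch.lean §1 (seat cruxidea-…-20541-3)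
  have hP : (fun U₀ => IsBackground (avOfRecord F N K) (bgReg F N K k ε) k V U₀) =
      (fun U₀ => IsBackground (avOfRecord F N K) (bgReg F N K k ε') k V U₀) := funext fun U₀ => propext (h U₀)
  have key : ∀ (P P' : GaugeField (F.P K) 0 (Node00.SU N) → Prop), P = P' →
      ∀ (h₁ : ∃ x, P x) (h₂ : ∃ x, P' x), Classical.choose h₁ = Classical.choose h₂ := by
    rintro P _ rfl _ _
    rfl
  by_cases hex : UkExists F N K k ε V
  · have hex' : UkExists F N K k ε' V := by
      obtain ⟨U₀, h₀⟩ := hex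
      exact ⟨U₀, (h U₀).1 h₀⟩
    rw [Uk_eq_choose hex, Uk_eq_choose hex']
    exact key _ _ hP hex hex'
  · have hex' : ¬ UkExists F N K k ε' V := fun ⟨U₀, h₀⟩ => hex ⟨U₀, (h U₀).2 h₀⟩
    rw [Uk_of_not hex, Uk_of_not hex']

/-- **L2 — (8)-MEMBERSHIP + SOLVABILITY ⇒ SAME SELECTION**: `ε ≤ ε′`, the radius-`ε′` problem solvable at `V`, every radius-`ε′` minimiser `ε`-regular ⇒ `U_k(ε; V) = U_k(ε′; V)`
(mutual minimality between the nested classes). [cite: Balaban1985Variational, Thm 1 (6),(8) p.279; Balaban1987RG1, (1.1)–(1.2) p.260 (bookkeeping)] -/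
theorem Uk_eq_of_le_of_forall_isBackground_mem (hle : ε ≤ ε') (hex : UkExists F N K k ε' V)
    (hreg : ∀ U₁, IsBackground (avOfRecord F N K) (bgReg F N K k ε') k V U₁ → U₁ ∈ bgReg F N K k ε) :
    Uk F N K k ε V = Uk F N K k ε' V :=
  Uk_eq_of_forall_isBackground_iff fun _ =>
    ⟨fun h₀ => isBackground_superset_of_exists_mem h₀ (bgReg_mono hle) (isBackground_Uk hex) (hreg _ (isBackground_Uk hex)),
     fun h₁ => isBackground_of_le_of_mem hle h₁ (hreg _ h₁)⟩

end ChoiceRigidity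

/-! ## §2  The rescaling gain: a `ρ·η_{k+1}²`-regular level-0 field is `ρ·η_k²`-regular -/

section Rescale

variable {F : T4Family} {N : ℕ} [NeZero N]

/-- `bgReg K (k+1) ρ ⊆ bgReg K k ρ` for `0 ≤ ρ`: `η_{k+1} = η_k∕L ≤ η_k` — the regularity class one level up is `L²` times smaller (the gain behind the lossless row (B)).
[cite: Balaban1987RG1, (0.1) p.251 and (1.2) p.260 (bookkeeping)] -/
theorem bgReg_succ_subset {ρ : ℝ} (hρ : 0 ≤ ρ) (K k : ℕ) : bgReg F N K (k + 1) ρ ⊆ bgReg F N K k ρ := by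
  intro U hU
  rw [mem_bgReg_iff] at hU ⊢
  have hL1 : (1 : ℝ) ≤ (F.P K).L := by exact_mod_cast (F.P K).L_pos
  have hη : (F.P K).eta (k + 1) ≤ (F.P K).eta k := by
    unfold Params.eta
    rw [pow_succ]
    exact mul_le_of_le_one_right (pow_nonneg (inv_nonneg.2 (by positivity)) _) (inv_le_one_of_one_le₀ hL1)
  have hη0 : 0 ≤ (F.P K).eta (k + 1) := by unfold Params.eta; positivity
  exact fun p => (hU p).trans_le (mul_le_mul_of_nonneg_left (pow_le_pow_left₀ hη0 hη 2) hρ)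

end Rescale

/-! ## §3  (T2″) at a first-form domain system: rows (N)(B) from restriction, uniqueness and the collar row -/

section FirstForm

variable (F : T4Family) (N : ℕ) [NeZero N]

/-- ★ **RADIUS BLINDNESS AT A FIRST-FORM DOMAIN SYSTEM, SELECTOR ROW DISPLAYED.**  Member letters as in (T2″); radii `a` (carrying every row) and `a′`; `ρ ≥ 0` the background-regularity
parameter of the domain system.  Rows: (hUo)(hU1) `U K k` open ∋ 1; (hsub)∕(hsup) `U K k` IS the first-form domain «radius-`a` problem solvable at `V` and EVERY radius-`a` minimiser `ρ·η_k²`-regular»;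
(hR) RESTRICTION — `U_{k+1}(a; W)` is a radius-`a` minimiser over its own `k`-fold average ([15] (9)–(10), [I] (1.1)); (hQ) uniqueness of the radius-`a` minimal orbit there; (hS) the
Lipschitz-(8) row on the (2.9)-collar — a field over `U_{k+1}` at which the `a`-cutoff is non-zero has its radius-`a` minimisers `ρ·η_k²`-regular ([15] §F); (hT) the continuity row on `U`;
(hU) selector agreement on `U` (displayed here; discharged in §4). ⊢ the two members have the same β of record. [cite: Balaban1987RG1, (1.20)–(1.22) p.264, (1.1)–(1.2) p.260, (0.21) p.256, (2.9) p.266; Balaban1985Variational, Thm 1 (6),(8)–(10) p.279 (bookkeeping)] -/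
theorem betaOfRecord₁₃_thm1CCMWZB_radiusBlind_firstForm (j : ℕ) (γ ε₀ ε₂₉ B₃ B₃' a₁ a a' ρ : ℝ) (Efl logz : B12.RunParams → ℕ → ℝ) (hρ : 0 ≤ ρ)
    (U : (K k : ℕ) → Set (GaugeField (F.P K) k (Node00.SU N))) (hUo : ∀ K k, IsOpen (U K k)) (hU1 : ∀ K k, (1 : GaugeField (F.P K) k (Node00.SU N)) ∈ U K k)
    (hsub : ∀ K k V, V ∈ U K k → UkExists F N K k a V ∧ ∀ U₁, IsBackground (avOfRecord F N K) (bgReg F N K k a) k V U₁ → U₁ ∈ bgReg F N K k ρ)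
    (hsup : ∀ K k V, UkExists F N K k a V → (∀ U₁, IsBackground (avOfRecord F N K) (bgReg F N K k a) k V U₁ → U₁ ∈ bgReg F N K k ρ) → V ∈ U K k)
    (hR : ∀ K k W, k < K → W ∈ U K (k + 1) →
      IsBackground (avOfRecord F N K) (bgReg F N K k a) k (Averaging.iter (avOfRecord F N K) k (Uk F N K (k + 1) a W)) (Uk F N K (k + 1) a W))
    (hQ : ∀ K k W, k < K → W ∈ U K (k + 1) → UniqueUkOrbit F N K k a (Averaging.iter (avOfRecord F N K) k (Uk F N K (k + 1) a W)))
    (hS : ∀ K k V, k < K → (avOfRecord F N K k).avg V ∈ U K (k + 1) → chiFix29OfRecord F N (numerics7OfThm1CCM F.L j ε₀ B₃ B₃' a a₁) ε₂₉ K k V ≠ 0 →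
      UkExists F N K k a V ∧ ∀ U₁, IsBackground (avOfRecord F N K) (bgReg F N K k a) k V U₁ → U₁ ∈ bgReg F N K k ρ)
    (hT : ∀ K (g : ℕ → ℝ) k, k < K → U K (k + 1) ⊆ regSetOfRecord F N K k
      (integrand (chiFixed29 F N (numerics7OfThm1CCM F.L j ε₀ B₃ B₃' a a₁) ε₂₉ K g k) (gfOfRecord F N K k) (g k)
        (effActionHT F N (TcanOfRecord F N) (chiFixed29 F N (numerics7OfThm1CCM F.L j ε₀ B₃ B₃' a a₁) ε₂₉) K g k)))
    (hU : ∀ K k W, k < K → W ∈ U K (k + 1) → Uk F N K (k + 1) a W = Uk F N K (k + 1) a' W) :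
    betaOfRecord₁₃ F N (theta13OfThm1CCMWZB F N j γ a ε₀ ε₂₉ B₃ B₃' a a₁ Efl logz) =
      betaOfRecord₁₃ F N (theta13OfThm1CCMWZB F N j γ a' ε₀ ε₂₉ B₃ B₃' a' a₁ Efl logz) := by
  refine betaOfRecord₁₃_thm1CCMWZB_radiusBlind_of_readSet F N j γ ε₀ ε₂₉ B₃ B₃' a₁ a a' Efl logz U hUo hU1 hU hT ?_ ?_
  · -- (N): the collar row puts the field in the first-form domain
    intro K k V hk hV hz
    exact hsup K k V (hS K k V hk hV hz).1 (hS K k V hk hV hz).2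
  · -- (B): restriction + uniqueness + the rescaling gain
    intro K k W hk hW
    have hex : UkExists F N K (k + 1) a W := (hsub K (k + 1) W hW).1
    have hmem : Uk F N K (k + 1) a W ∈ bgReg F N K k ρ :=
      bgReg_succ_subset hρ K k ((hsub K (k + 1) W hW).2 _ (isBackground_Uk hex))
    refine hsup K k _ ⟨_, hR K k W hk hW⟩ fun U₁ h₁ => ?_
    exact (mem_bgReg_iff_of_orbitRel (hQ K k W hk hW _ _ h₁ (hR K k W hk hW))).2 hmem

/-! ## §4  The selector row discharged: DOWNWARD for free, UPWARD from one (8)-shaped row -/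

/-- ★★ **DOWNWARD RADIUS BLINDNESS** (`a′ ≤ a`, `0 ≤ ρ ≤ a′`): on the first-form domain system of radius `a` and regularity `ρ ≤ a′` the selector row is FREE — every radius-`a` minimiser over a domain
field is `a′`-regular, hence (mutual minimality, L2) the radius-`a′` selector returns the same configuration.  Remaining rows: first-form sandwich (+ openness), restriction, uniqueness, collar,
continuity — all at the ONE radius `a`. [cite: Balaban1987RG1, (1.20)–(1.22) p.264, (1.1)–(1.2) p.260; Balaban1985Variational, Thm 1 (6),(8)–(10) p.279 (bookkeeping)] -/
theorem betaOfRecord₁₃_thm1CCMWZB_radiusBlind_firstForm_down (j : ℕ) (γ ε₀ ε₂₉ B₃ B₃' a₁ a a' ρ : ℝ) (Efl logz : B12.RunParams → ℕ → ℝ)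
    (hρ : 0 ≤ ρ) (hρa : ρ ≤ a') (hle : a' ≤ a)
    (U : (K k : ℕ) → Set (GaugeField (F.P K) k (Node00.SU N))) (hUo : ∀ K k, IsOpen (U K k)) (hU1 : ∀ K k, (1 : GaugeField (F.P K) k (Node00.SU N)) ∈ U K k)
    (hsub : ∀ K k V, V ∈ U K k → UkExists F N K k a V ∧ ∀ U₁, IsBackground (avOfRecord F N K) (bgReg F N K k a) k V U₁ → U₁ ∈ bgReg F N K k ρ)
    (hsup : ∀ K k V, UkExists F N K k a V → (∀ U₁, IsBackground (avOfRecord F N K) (bgReg F N K k a) k V U₁ → U₁ ∈ bgReg F N K k ρ) → V ∈ U K k)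
    (hR : ∀ K k W, k < K → W ∈ U K (k + 1) →
      IsBackground (avOfRecord F N K) (bgReg F N K k a) k (Averaging.iter (avOfRecord F N K) k (Uk F N K (k + 1) a W)) (Uk F N K (k + 1) a W))
    (hQ : ∀ K k W, k < K → W ∈ U K (k + 1) → UniqueUkOrbit F N K k a (Averaging.iter (avOfRecord F N K) k (Uk F N K (k + 1) a W)))
    (hS : ∀ K k V, k < K → (avOfRecord F N K k).avg V ∈ U K (k + 1) → chiFix29OfRecord F N (numerics7OfThm1CCM F.L j ε₀ B₃ B₃' a a₁) ε₂₉ K k V ≠ 0 →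
      UkExists F N K k a V ∧ ∀ U₁, IsBackground (avOfRecord F N K) (bgReg F N K k a) k V U₁ → U₁ ∈ bgReg F N K k ρ)
    (hT : ∀ K (g : ℕ → ℝ) k, k < K → U K (k + 1) ⊆ regSetOfRecord F N K k
      (integrand (chiFixed29 F N (numerics7OfThm1CCM F.L j ε₀ B₃ B₃' a a₁) ε₂₉ K g k) (gfOfRecord F N K k) (g k)
        (effActionHT F N (TcanOfRecord F N) (chiFixed29 F N (numerics7OfThm1CCM F.L j ε₀ B₃ B₃' a a₁) ε₂₉) K g k))) :
    betaOfRecord₁₃ F N (theta13OfThm1CCMWZB F N j γ a ε₀ ε₂₉ B₃ B₃' a a₁ Efl logz) =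
      betaOfRecord₁₃ F N (theta13OfThm1CCMWZB F N j γ a' ε₀ ε₂₉ B₃ B₃' a' a₁ Efl logz) :=
  betaOfRecord₁₃_thm1CCMWZB_radiusBlind_firstForm F N j γ ε₀ ε₂₉ B₃ B₃' a₁ a a' ρ Efl logz hρ U hUo hU1 hsub hsup hR hQ hS hT
    fun K k W _ hW =>
      (Uk_eq_of_le_of_forall_isBackground_mem hle (hsub K (k + 1) W hW).1
        fun U₁ h₁ => bgReg_mono hρa ((hsub K (k + 1) W hW).2 U₁ h₁)).symm

/-- ★ **UPWARD RADIUS BLINDNESS** (`a ≤ a′`): the selector row from one (8)-shaped row (h8up) — the radius-`a′` problem is solvable on the domain and every radius-`a′` minimiser there is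
`a`-regular ([15] Thm 1 (8) with `B₃·(regularity of the field) ≤ a`; the field's regularity is the domain's, `∝ ρ∕L² + collar`). [cite: Balaban1985Variational, Thm 1 (6),(8) p.279; Balaban1987RG1, (1.1)–(1.2) p.260, (1.20)–(1.22) p.264 (bookkeeping)] -/
theorem betaOfRecord₁₃_thm1CCMWZB_radiusBlind_firstForm_up (j : ℕ) (γ ε₀ ε₂₉ B₃ B₃' a₁ a a' ρ : ℝ) (Efl logz : B12.RunParams → ℕ → ℝ)
    (hρ : 0 ≤ ρ) (hle : a ≤ a')
    (U : (K k : ℕ) → Set (GaugeField (F.P K) k (Node00.SU N))) (hUo : ∀ K k, IsOpen (U K k)) (hU1 : ∀ K k, (1 : GaugeField (F.P K) k (Node00.SU N)) ∈ U K k)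
    (hsub : ∀ K k V, V ∈ U K k → UkExists F N K k a V ∧ ∀ U₁, IsBackground (avOfRecord F N K) (bgReg F N K k a) k V U₁ → U₁ ∈ bgReg F N K k ρ)
    (hsup : ∀ K k V, UkExists F N K k a V → (∀ U₁, IsBackground (avOfRecord F N K) (bgReg F N K k a) k V U₁ → U₁ ∈ bgReg F N K k ρ) → V ∈ U K k)
    (hR : ∀ K k W, k < K → W ∈ U K (k + 1) →
      IsBackground (avOfRecord F N K) (bgReg F N K k a) k (Averaging.iter (avOfRecord F N K) k (Uk F N K (k + 1) a W)) (Uk F N K (k + 1) a W))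
    (hQ : ∀ K k W, k < K → W ∈ U K (k + 1) → UniqueUkOrbit F N K k a (Averaging.iter (avOfRecord F N K) k (Uk F N K (k + 1) a W)))
    (hS : ∀ K k V, k < K → (avOfRecord F N K k).avg V ∈ U K (k + 1) → chiFix29OfRecord F N (numerics7OfThm1CCM F.L j ε₀ B₃ B₃' a a₁) ε₂₉ K k V ≠ 0 →
      UkExists F N K k a V ∧ ∀ U₁, IsBackground (avOfRecord F N K) (bgReg F N K k a) k V U₁ → U₁ ∈ bgReg F N K k ρ)
    (hT : ∀ K (g : ℕ → ℝ) k, k < K → U K (k + 1) ⊆ regSetOfRecord F N K k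
      (integrand (chiFixed29 F N (numerics7OfThm1CCM F.L j ε₀ B₃ B₃' a a₁) ε₂₉ K g k) (gfOfRecord F N K k) (g k)
        (effActionHT F N (TcanOfRecord F N) (chiFixed29 F N (numerics7OfThm1CCM F.L j ε₀ B₃ B₃' a a₁) ε₂₉) K g k)))
    (h8up : ∀ K k W, k < K → W ∈ U K (k + 1) →
      UkExists F N K (k + 1) a' W ∧ ∀ U₁, IsBackground (avOfRecord F N K) (bgReg F N K (k + 1) a') (k + 1) W U₁ → U₁ ∈ bgReg F N K (k + 1) a) :
    betaOfRecord₁₃ F N (theta13OfThm1CCMWZB F N j γ a ε₀ ε₂₉ B₃ B₃' a a₁ Efl logz) =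
      betaOfRecord₁₃ F N (theta13OfThm1CCMWZB F N j γ a' ε₀ ε₂₉ B₃ B₃' a' a₁ Efl logz) :=
  betaOfRecord₁₃_thm1CCMWZB_radiusBlind_firstForm F N j γ ε₀ ε₂₉ B₃ B₃' a₁ a a' ρ Efl logz hρ U hUo hU1 hsub hsup hR hQ hS hT
    fun K k W hk hW => Uk_eq_of_le_of_forall_isBackground_mem hle (h8up K k W hk hW).1 (h8up K k W hk hW).2

end FirstForm

end Summit.QuantumFields.YangMills.BalabanUVNodes.K0Beta13RadiusBlindFirstForm
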